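import Literature.NumberTheory.DiophantineGeometry.WeilPairingRationalTateModule
import Literature.NumberTheory.DiophantineGeometry.AVTorsionFramedGaloisRep
import Literature.NumberTheory.GaloisRepresentations.SymplecticMultiplier
import Literature.NumberTheory.GaloisRepresentations.ModPGaloisRepCyclotomicProofs
import HarnessLib

/-!
# `H¹(A, ℚ̄_p)` and `H¹(A, 𝔽_p) ⊗ k` are symplectic of multiplier `ε⁻¹`, from the Weil pairing

Topic `NumberTheory/DiophantineGeometry`; theorems only (no definition, no named fact, no `sorry`).
Landed by the provefact seat of
`Literature.NumberTheory.DiophantineGeometry.bcgp_serreWreathFixedSimilitude_implies_quadraticImprimitiveSurfacesModular`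
to make the two "multiplier" clauses of the good-prime binder of
`BcgpSerreWreathFixedSimilitudeImprimitiveSurfacesProofs.lean` consequences of the tree's NAMED FACT
`Literature.NumberTheory.DiophantineGeometry.weilPairing_rationalTateModule` (Milne, *Abelian
varieties*, §16; Mumford §20: a non-degenerate alternating `Γ_K`-form on `V_p B` with multiplier
`χ_p`) instead of carrying them as hypotheses.

Source statement (G. Boxer, F. Calegari, T. Gee, V. Pilloni, *Modularity theorems for abelian
surfaces*, arXiv:2502.20645, §1.8.11, chunk p. 11 of the arXiv text layer, lines 44–70): "For each
prime `p`, we may write `ρ_{A,p}` for the Galois representation associated to `H¹(A_F̄, ℤ_p)`. We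
often think of `ρ_{A,p}` as a representation `ρ_{A,p} : G_F → GSp₄(ℚ_p)` with multiplier given by
the inverse cyclotomic character `ε⁻¹` … We also let `ρ̄_{A,p}` denote the Galois representation
associated to `H¹(A_F̄, 𝔽_p)`. If `A` admits a principal polarization of degree prime to `p`, then
we can and do think of `ρ̄_{A,p}` as a representation `ρ̄_{A,p} : G_F → GSp₄(𝔽̄_p)` … the Galois
representations associated to `T_p(A)` and `A[p]` are the dual representations".

## What is proved

* `isSymplecticWithMultiplierFun_dualFramed_of_weilPairing` — **`p`-adic level.** Granted
  `weilPairing_rationalTateModule`, for an abelian variety `B/K` (`K : Type`), a prime `p`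
  invertible in `K`, any `ℚ_p`-basis `b` of `V_p B` and the framed dual
  `r(g) = [g⁻¹]_bᵀ ⊗ ℚ̄_p` (`H¹_ét(B_K̄, ℚ̄_p)` in the dual basis), `r` is symplectic of multiplier
  `χ_p⁻¹` (Gram matrix: the inverse of the Gram matrix of the Weil form in `b`). This is the matrix
  identity "the dual of a symplectic representation is symplectic for `J⁻¹` with the inverse
  multiplier" (`symplectic_inv_gram_identity`); same argument as
  `Summits/…/PhantomRMYoshidaStableYoshidaCongruenceFramedH1.lean` (`isSymplectic_framedH1`), which
  a Literature file may not import.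
* `exists_alternating_gram_torsionFrame_of_bilinForm` — **reduction of a primitive lattice form.**
  For an abelian group `A` with `G`-action and `#A[pⁿ] = p^{dn}` (`d > 0`), a non-degenerate
  alternating `ℚ_p`-form on `V_p A = ℚ_p ⊗ T_p A` with multiplier `χ : G → ℤ_p`, and any additive
  frame `e : A[p] ≃ (ℤ/p)^d` with matrices `ρ(g)`: there is `J₁ ∈ M_d(𝔽_p)`, `J₁ᵀ = −J₁`, `J₁ ≠ 0`,
  with `ρ(g)ᵀ J₁ ρ(g) = (χ(g) mod p) J₁` for all `g`. Proof: in a `ℤ_p`-basis of `T_p A` the Gram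
  matrix `J ∈ M_d(ℚ_p)` satisfies `N_gᵀ J N_g = χ(g) J` with `N_g ∈ M_d(ℤ_p)` the matrix of `g` on
  `T_p A` (`LinearMap.toMatrix_baseChange`); rescale `J` by its entry of largest norm to a
  PRIMITIVE integral matrix `J₀` (an entry equal to `1`); reduce mod `p` (`T_p A / p = A[p]`,
  `toMatrix_torsionBy_smul_eq_map`, Serre–Tate 1968 §1) and change basis to the frame `e`.
* `isSymplecticWithMultiplierFun_dualTorsionFrame_baseChange_of_weilPairing_of_isIrreducible` —
  **mod-`p` level.** Granted `weilPairing_rationalTateModule`, for `B/K`, `p` invertible in `K`,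
  `d = 2 dim B`, a frame `(ρ₀, e)` of `B[p](K̄)`, a topological field `k` of characteristic `p` and
  `ι : 𝔽_p → k`: if `ρ̄ := ρ₀^∨ ⊗_ι k` (the representation on `H¹(B_K̄, 𝔽_p) ⊗ k` in the dual
  frame) is IRREDUCIBLE, then `ρ̄` is symplectic of multiplier `ε̄⁻¹ = (χ_p mod p)⁻¹` (pushed to
  `k`). The point: the reduced form `J₁` may be degenerate (the lattice `T_p B` need not be
  self-dual — in print this is where "a polarization of degree prime to `p`" enters), but its
  RANGE `J₁ k^d ≠ 0` is a `ρ̄`-stable subspace (`(N⁻¹)ᵀ J₁ = χ̄⁻¹ J₁ N`), so irreducibility forces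
  `J₁` invertible, and then `J₁⁻¹` is a Gram matrix for the dual with the inverse multiplier.
  So for the residual representations met in the BCGP good-prime binders (irreducible, indeed
  with image `Δ_p ⋊ C₂`) the printed "`ρ̄_{A,p} : G_ℚ → GSp₄(𝔽̄_p)` with similitude `ε̄⁻¹`" needs no
  hypothesis on polarizations (deviation from print, which uses a prime-to-`p` polarization: the
  tree has the `V_p` pairing as a named fact but no polarization degrees; this road is shorter and
  suffices for irreducible residual representations).
* Surface specialisations (`K = ℚ`, `d = 4`) in the exact binder shapes of
  `BcgpSerreWreathFixedSimilitudeImprimitiveSurfacesProofs.lean`: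
  `isSymplecticWithMultiplierFun_dualFramed_surface_of_weilPairing`,
  `isSymplecticWithMultiplierFun_dualTorsionFrame_baseChange_surface_of_weilPairing_of_isIrreducible`.

No named fact is introduced (D-0026); the only unproved input is the existing named fact
`weilPairing_rationalTateModule`, taken as an explicit hypothesis `hWeil`.

## References

* [BoxerCalegariGeePilloni2025] G. Boxer, F. Calegari, T. Gee, V. Pilloni, *Modularity theorems for
  abelian surfaces*, arXiv:2502.20645, §1.8.11 (chunk p. 11, lines 44–70).
* [Milne1986AbelianVarieties] J. S. Milne, *Abelian varieties*, in Cornell–Silverman (1986), §16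
  (Lemma 16.1, Lemma 16.2 (e)).
* [MumfordAV1970] D. Mumford, *Abelian Varieties* (1970), §20.
* [SerreTate1968] J.-P. Serre, J. Tate, *Good reduction of abelian varieties*, Ann. of Math. 88
  (1968), §1 (`T_p/p = A[p]`, `V_p = T_p ⊗ ℚ_p`).
* [BoxerEtAl2021] G. Boxer, F. Calegari, T. Gee, V. Pilloni, *Abelian surfaces over totally real
  fields are potentially modular*, Publ. Math. IHÉS 134 (2021), §2 (`GSp₄`, similitude).
-/

noncomputable section

open scoped TensorProduct Matrix MatrixGroups AddSubgroup
open Matrix Field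

namespace Literature.NumberTheory.DiophantineGeometry

open Literature.NumberTheory.GaloisRepresentations Literature.NumberTheory.EllipticCurves
open Literature.AlgebraicGeometry.Motives (AbelianVariety)

universe u v

/-! ## 1. Matrix algebra -/

section MatrixAlgebra

variable {F : Type*} [Field F] {m : Type*} [Fintype m] [DecidableEq m]

/-- **The dual of a symplectic matrix is symplectic for the inverse Gram matrix with the inverse
multiplier**: if `M M' = 1`, `Mᵀ J M = c • J`, `c c' = 1` and `det J ≠ 0`, then
`M' J⁻¹ M'ᵀ = c' • J⁻¹`. [cite: BoxerEtAl2021, §2] -/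
theorem symplectic_inv_gram_identity {M M' J : Matrix m m F} {c c' : F} (hMM' : M * M' = 1)
    (hJ : J.det ≠ 0) (hE : Mᵀ * J * M = c • J) (hcc' : c * c' = 1) :
    M' * J⁻¹ * M'ᵀ = c' • J⁻¹ := by
  have hJu : IsUnit J.det := isUnit_iff_ne_zero.2 hJ
  have h1 : M' * J⁻¹ * M'ᵀ * (Mᵀ * J * M) = M' * M := by
    calc M' * J⁻¹ * M'ᵀ * (Mᵀ * J * M)
        = M' * J⁻¹ * (M * M')ᵀ * J * M := by
          rw [Matrix.transpose_mul]; simp only [Matrix.mul_assoc]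
      _ = M' * M := by
          rw [hMM', Matrix.transpose_one, Matrix.mul_one, Matrix.mul_assoc M',
            Matrix.nonsing_inv_mul J hJu, Matrix.mul_one]
  have hM'M : M' * M = 1 := mul_eq_one_comm.1 hMM'
  rw [hE, hM'M, Matrix.mul_smul] at h1
  have h2 : M' * J⁻¹ * M'ᵀ * J = c' • (1 : Matrix m m F) := by
    have := congrArg (fun A : Matrix m m F => c' • A) h1
    simp only [smul_smul, mul_comm c' c, hcc', one_smul] at this
    rw [this]
  calc M' * J⁻¹ * M'ᵀ = M' * J⁻¹ * M'ᵀ * J * J⁻¹ := by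
        rw [Matrix.mul_assoc _ J, Matrix.mul_nonsing_inv J hJu, Matrix.mul_one]
    _ = c' • J⁻¹ := by rw [h2, Matrix.smul_mul, Matrix.one_mul]

/-- **The range of a (possibly degenerate) invariant form is stable under the dual action.**  If
`N` is invertible and `Nᵀ J N = c • J` with `c ≠ 0`, then `(N⁻¹)ᵀ` maps the column space
`J F^m` into itself: `(N⁻¹)ᵀ (J x) = J (c⁻¹ • N x)`. [folklore] -/
theorem transpose_inv_mulVec_mem_range_of_transpose_mul_mul {N J : Matrix m m F} {c : F}
    (hN : IsUnit N.det) (hE : Nᵀ * J * N = c • J) (hc : c ≠ 0) (x : m → F) :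
    ∃ y : m → F, (N⁻¹)ᵀ *ᵥ (J *ᵥ x) = J *ᵥ y := by
  refine ⟨c⁻¹ • (N *ᵥ x), ?_⟩
  -- `(N⁻¹)ᵀ J = c⁻¹ • J N`
  have hNt : IsUnit Nᵀ.det := by rwa [Matrix.det_transpose]
  have key : (N⁻¹)ᵀ * J = c⁻¹ • (J * N) := by
    have h1 : Nᵀ * (J * N) = c • J := by rw [← Matrix.mul_assoc, hE]
    have h2 : J * N = (Nᵀ)⁻¹ * (c • J) := by
      rw [← h1, ← Matrix.mul_assoc, Matrix.nonsing_inv_mul _ hNt, Matrix.one_mul]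
    rw [h2, Matrix.mul_smul, smul_smul, inv_mul_cancel₀ hc, one_smul, Matrix.transpose_nonsing_inv]
  rw [Matrix.mulVec_mulVec, key, Matrix.smul_mulVec, ← Matrix.mulVec_mulVec,
    Matrix.mulVec_smul]

/-- A non-zero square matrix over a field whose column space is everything is invertible
(`Matrix.mulVec_surjective_iff_isUnit`). [folklore] -/
theorem isUnit_det_of_range_mulVecLin_eq_top {J : Matrix m m F}
    (h : LinearMap.range J.mulVecLin = ⊤) : IsUnit J.det := by
  rw [← Matrix.isUnit_iff_isUnit_det, ← Matrix.mulVec_surjective_iff_isUnit]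
  intro y
  have hy : y ∈ LinearMap.range J.mulVecLin := h ▸ Submodule.mem_top
  obtain ⟨x, hx⟩ := hy
  exact ⟨x, hx⟩

/-- A non-zero matrix has a non-zero column-space: `J ≠ 0 → range J ≠ ⊥`. [folklore] -/
theorem range_mulVecLin_ne_bot_of_ne_zero {J : Matrix m m F} (hJ : J ≠ 0) :
    LinearMap.range J.mulVecLin ≠ ⊥ := by
  intro h
  apply hJ
  ext i j
  have hmem : J *ᵥ Pi.single j 1 ∈ LinearMap.range J.mulVecLin := ⟨Pi.single j 1, rfl⟩
  rw [h, Submodule.mem_bot] at hmem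
  have := congrFun hmem i
  rwa [Matrix.mulVec_single_one, Matrix.col_apply] at this

end MatrixAlgebra

/-! ## 2. Rescaling a non-zero `p`-adic matrix to a primitive integral one -/

section Primitive

variable {p : ℕ} [Fact p.Prime] {m : Type*} [Fintype m]

/-- **Primitive integral rescaling.**  A non-zero matrix `J ∈ M_m(ℚ_p)` is `u • J₀` with
`u ∈ ℚ_pˣ` and `J₀ ∈ M_m(ℤ_p)` having an entry equal to `1` (divide by an entry of maximal norm).
[folklore] -/
theorem exists_eq_smul_map_padicInt_of_ne_zero (J : Matrix m m ℚ_[p]) (hJ : J ≠ 0) :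
    ∃ (u : ℚ_[p]) (J₀ : Matrix m m ℤ_[p]), u ≠ 0 ∧
      J = u • J₀.map (algebraMap ℤ_[p] ℚ_[p]) ∧ ∃ i j, J₀ i j = 1 := by
  classical
  -- an entry of maximal norm
  have hne : ∃ i j, J i j ≠ 0 := by
    by_contra h
    push Not at h
    exact hJ (Matrix.ext fun i j => by rw [h i j, Matrix.zero_apply])
  obtain ⟨i₁, j₁, h₁⟩ := hne
  obtain ⟨⟨i₀, j₀⟩, -, hmax⟩ := (Finset.univ : Finset (m × m)).exists_max_image
    (fun ij => ‖J ij.1 ij.2‖) ⟨(i₁, j₁), Finset.mem_univ _⟩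
  set u := J i₀ j₀ with hu
  have hle : ∀ i j, ‖J i j‖ ≤ ‖u‖ := fun i j => hmax (i, j) (Finset.mem_univ _)
  have hu0 : u ≠ 0 := by
    intro h0
    have := hle i₁ j₁
    rw [h0, norm_zero, norm_le_zero_iff] at this
    exact h₁ this
  have hnorm : ∀ i j, ‖J i j / u‖ ≤ 1 := fun i j => by
    rw [norm_div, div_le_one (norm_pos_iff.2 hu0)]
    exact hle i j
  refine ⟨u, Matrix.of fun i j => (⟨J i j / u, hnorm i j⟩ : ℤ_[p]), hu0, ?_, i₀, j₀, ?_⟩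
  · ext i j
    rw [Matrix.smul_apply, Matrix.map_apply, Matrix.of_apply, smul_eq_mul]
    change J i j = u * (J i j / u)
    rw [mul_div_cancel₀ _ hu0]
  · rw [Matrix.of_apply]
    apply Subtype.ext
    change J i₀ j₀ / u = ((1 : ℤ_[p]) : ℚ_[p])
    rw [hu, div_self (hu ▸ hu0), PadicInt.coe_one]

omit [Fintype m] in
/-- Cancelling a unit scalar and the (injective) coefficient extension `ℤ_p → ℚ_p` in a matrix
identity. [folklore] -/
theorem map_padicInt_injective_of_smul_eq {m' : Type*} {u : ℚ_[p]} (hu : u ≠ 0)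
    {X Y : Matrix m m' ℤ_[p]}
    (h : u • X.map (algebraMap ℤ_[p] ℚ_[p]) = u • Y.map (algebraMap ℤ_[p] ℚ_[p])) : X = Y :=
  Matrix.map_injective (IsFractionRing.injective ℤ_[p] ℚ_[p]) (smul_right_injective _ hu h)

end Primitive

/-! ## 3. The `p`-adic level: the framed dual of `V_p B` is symplectic of multiplier `χ_p⁻¹` -/

section PadicLevel

variable {K : Type} [Field K] (B : AbelianVariety K) (p : ℕ) [Fact p.Prime]

/-- **`H¹_ét(B_K̄, ℚ̄_p)` is symplectic with multiplier `ε⁻¹`, from the Weil pairing fact.**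
Granted `weilPairing_rationalTateModule` (Milne §16: a non-degenerate alternating `Γ_K`-form `e`
on `V_p B` with `e(gx, gy) = χ_p(g) e(x, y)`), for `p` invertible in `K`, any `ℚ_p`-basis `b` of
`V_p B` and any framed `r : Γ_K →ₜ* GL_n(ℚ̄_p)` with `r(g) = [g⁻¹]_bᵀ ⊗ ℚ̄_p` (the dual in the dual
basis), `r` preserves `J⁻¹ ⊗ ℚ̄_p` up to the scalar `χ_p(g)⁻¹`, `J` the Gram matrix of `e` in `b`;
i.e. `r : Γ_K → GSp_n(ℚ̄_p)` with similitude `ε⁻¹` (BCGP 2025, §1.8.11: "`ρ_{A,p} : G_F → GSp₄(ℚ_p)`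
with multiplier given by the inverse cyclotomic character `ε⁻¹`").
[cite: BoxerCalegariGeePilloni2025, §1.8.11] [cite: Milne1986AbelianVarieties, §16 (Lemma 16.2 (e))] -/
theorem isSymplecticWithMultiplierFun_dualFramed_of_weilPairing
    (hWeil : weilPairing_rationalTateModule) (hp : (p : K) ≠ 0) {n : ℕ}
    (b : Module.Basis (Fin n) ℚ_[p] (B.rationalTateModule p))
    (r : FramedGaloisRep K (PadicAlgCl p) n)
    (hr : ∀ g : absoluteGaloisGroup K,
      (r g).val = ((LinearMap.toMatrix b b (B.rationalTateRep p g⁻¹)).map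
        (algebraMap ℚ_[p] (PadicAlgCl p))).transpose) :
    r.IsSymplecticWithMultiplierFun (fun g => algebraMap ℚ_[p] (PadicAlgCl p)
      ((((GaloisRep.cyclotomicCharacter K p g)⁻¹ : ℤ_[p]ˣ) : ℤ_[p]) : ℚ_[p])) := by
  classical
  obtain ⟨e, halt, hnd, heq⟩ := hWeil B p hp
  set V := B.rationalTateRep p
  set J : Matrix (Fin n) (Fin n) ℚ_[p] := LinearMap.BilinForm.toMatrix b e with hJdef
  set f := algebraMap ℚ_[p] (PadicAlgCl p)
  set c : absoluteGaloisGroup K → ℚ_[p] :=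
    fun g => (((GaloisRep.cyclotomicCharacter K p g : ℤ_[p]ˣ) : ℤ_[p]) : ℚ_[p]) with hc
  -- the Gram matrix is alternating and invertible
  have hJt : Jᵀ = -J := by
    ext i j
    simp only [Matrix.transpose_apply, Matrix.neg_apply, hJdef, LinearMap.BilinForm.toMatrix_apply]
    exact (halt.neg_eq (b i) (b j)).symm
  have hJdet : J.det ≠ 0 :=
    Matrix.nondegenerate_iff_det_ne_zero.1 ((LinearMap.BilinForm.nondegenerate_toMatrix_iff b).2 hnd)
  -- equivariance in the basis `b`
  have hE : ∀ g, (LinearMap.toMatrix b b (V g))ᵀ * J * LinearMap.toMatrix b b (V g) = c g • J := by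
    intro g
    have hcomp : e.comp (V g) (V g) = c g • e := by
      refine LinearMap.ext fun x => LinearMap.ext fun y => ?_
      rw [LinearMap.BilinForm.comp_apply, LinearMap.smul_apply, LinearMap.smul_apply, smul_eq_mul]
      exact heq g x y
    rw [hJdef, ← LinearMap.BilinForm.toMatrix_comp b b e (V g) (V g), hcomp, map_smul]
  have hMM' : ∀ g, LinearMap.toMatrix b b (V g) * LinearMap.toMatrix b b (V g⁻¹) = 1 := by
    intro g
    rw [← LinearMap.toMatrix_mul, ← map_mul, mul_inv_cancel, map_one, LinearMap.toMatrix_one]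
  have hcc' : ∀ g, c g * c g⁻¹ = 1 := by
    intro g
    simp only [hc]
    rw [← PadicInt.coe_mul, ← Units.val_mul, ← map_mul, mul_inv_cancel, map_one, Units.val_one,
      PadicInt.coe_one]
  have hJu : IsUnit J.det := isUnit_iff_ne_zero.2 hJdet
  have hJinvt : (J⁻¹)ᵀ = -J⁻¹ := by
    rw [Matrix.transpose_nonsing_inv, hJt]
    refine Matrix.inv_eq_right_inv ?_
    rw [neg_mul_neg, Matrix.mul_nonsing_inv J hJu]
  -- the inverse Gram matrix is preserved by the inverse-transpose matrices, multiplier `c⁻¹`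
  have hdual : ∀ g, LinearMap.toMatrix b b (V g⁻¹) * J⁻¹ * (LinearMap.toMatrix b b (V g⁻¹))ᵀ =
      c g⁻¹ • J⁻¹ :=
    fun g => symplectic_inv_gram_identity (hMM' g) hJdet (hE g) (hcc' g)
  have hcinv : ∀ g, c g⁻¹ = ((((GaloisRep.cyclotomicCharacter K p g)⁻¹ : ℤ_[p]ˣ) : ℤ_[p]) : ℚ_[p]) :=
    fun g => by simp only [hc, map_inv]
  -- the symplectic form for the dual: `J⁻¹`, mapped to `ℚ̄_p`
  refine ⟨f.mapMatrix J⁻¹, ?_, ?_, fun g => ?_⟩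
  · rw [RingHom.mapMatrix_apply, ← Matrix.transpose_map, hJinvt]
    exact (map_neg f.mapMatrix J⁻¹)
  · rw [← RingHom.map_det]
    exact (Matrix.isUnit_nonsing_inv_det J hJu).map f
  · have hval : (r g).val = (f.mapMatrix (LinearMap.toMatrix b b (V g⁻¹)))ᵀ := by
      rw [hr g, RingHom.mapMatrix_apply]
    rw [hval, Matrix.transpose_transpose, RingHom.mapMatrix_apply, RingHom.mapMatrix_apply,
      ← Matrix.transpose_map, ← Matrix.map_mul, ← Matrix.map_mul, hdual g,
      Matrix.map_smul' _ _ _ (map_mul f), hcinv g]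

end PadicLevel

/-! ## 4. Reduction of a primitive lattice form: `T_p A / p = A[p]` -/

section Lattice

open Literature.NumberTheory.EllipticCurves.TateModule

variable {A : Type u} [AddCommGroup A] {p : ℕ} [Fact p.Prime] {d : ℕ}
variable {G : Type v} [Monoid G] [DistribMulAction G A]

/-- **An invariant form on `V_p A` leaves a non-zero alternating invariant matrix on `A[p]`.**
Let `A` be an abelian group with an action of a monoid `G` and `#A[pⁿ] = p^{dn}` for all `n`
(`d > 0`), `E` a non-degenerate alternating `ℚ_p`-bilinear form on `V_p A = ℚ_p ⊗ T_p A` with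
`E(gx, gy) = χ(g) E(x, y)` for a function `χ : G → ℤ_p`, and `e : A[p] ≃ (ℤ/p)^d` an additive
frame in which `G` acts through matrices `ρ(g)` (`e (g • P) = ρ(g) · e(P)`).  Then some
`J₁ ∈ M_d(𝔽_p)` with `J₁ᵀ = −J₁`, `J₁ ≠ 0` satisfies `ρ(g)ᵀ J₁ ρ(g) = (χ(g) mod p) J₁` for every
`g`.  Proof (Serre–Tate 1968, §1: `T_p/p = A[p]`, `V_p = T_p ⊗ ℚ_p`): in a `ℤ_p`-basis `b` of
`T_p A`, the Gram matrix `J` of `E` (in `1 ⊗ b`) satisfies `N_gᵀ J N_g = χ(g) J` with `N_g` the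
INTEGRAL matrix of `g` on `T_p A` (`LinearMap.toMatrix_baseChange`); write `J = u J₀` with `J₀`
integral having an entry `1` (`exists_eq_smul_map_padicInt_of_ne_zero`); the identity descends to
`J₀` over `ℤ_p`, reduces mod `p` to the matrix of `g` on `A[p]` in the reduced basis
(`toMatrix_torsionBy_smul_eq_map`), and is transported to the frame `e` by a change of basis.
(The reduced form may be degenerate: `T_p A` need not be self-dual for `E`.) [cite: SerreTate1968, §1] -/
theorem exists_alternating_gram_torsionFrame_of_bilinForm
    (hcard : ∀ n, Nat.card (A[(p ^ n : ℕ)]) = p ^ (d * n)) (hd : 0 < d)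
    (E : LinearMap.BilinForm ℚ_[p] (RationalTateModule A p)) (hEalt : E.IsAlt)
    (hEnd : E.Nondegenerate) (χ : G → ℤ_[p])
    (hEχ : ∀ (g : G) (x y : RationalTateModule A p),
      E (rationalTateRepresentation G A p g x) (rationalTateRepresentation G A p g y) =
        (χ g : ℚ_[p]) * E x y)
    (e : A[(p : ℕ)] ≃+ (Fin d → ZMod p)) (ρ : G → Matrix (Fin d) (Fin d) (ZMod p))
    (he : ∀ (g : G) (P : A[(p : ℕ)]), e (g • P) = ρ g *ᵥ e P) :
    ∃ J₁ : Matrix (Fin d) (Fin d) (ZMod p), J₁ᵀ = -J₁ ∧ J₁ ≠ 0 ∧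
      ∀ g : G, (ρ g)ᵀ * J₁ * ρ g = PadicInt.toZMod (χ g) • J₁ := by
  classical
  haveI := free_of_card_torsionBy_rank hcard
  haveI := finite_of_card_torsionBy_rank hcard
  haveI : Nonempty (Fin d) := ⟨⟨0, hd⟩⟩
  letI : Module (ZMod p) (A[(p : ℕ)]) := AddSubgroup.torsionBy.zmodModule
  haveI : Finite (A[(p : ℕ)]) := by simpa using finite_torsionBy_of_card hcard 1
  -- a `ℤ_p`-basis of `T_p A`, and the `ℚ_p`-basis `1 ⊗ b` of `V_p A`
  let b : Module.Basis (Fin d) ℤ_[p] (TateModule A p) :=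
    Module.finBasisOfFinrankEq ℤ_[p] (TateModule A p) (finrank_eq_of_card_torsionBy hcard)
  let c : Module.Basis (Fin d) ℚ_[p] (RationalTateModule A p) := Algebra.TensorProduct.basis ℚ_[p] b
  set T := tateRepresentation G A p with hT
  set V := rationalTateRepresentation G A p with hV
  set f := algebraMap ℤ_[p] ℚ_[p] with hf
  -- the Gram matrix: alternating, invertible, hence non-zero, and `G`-equivariant
  set J : Matrix (Fin d) (Fin d) ℚ_[p] := LinearMap.BilinForm.toMatrix c E with hJdef
  have hJt : Jᵀ = -J := by
    ext i j
    simp only [Matrix.transpose_apply, Matrix.neg_apply, hJdef, LinearMap.BilinForm.toMatrix_apply]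
    exact (hEalt.neg_eq (c i) (c j)).symm
  have hJdet : J.det ≠ 0 :=
    Matrix.nondegenerate_iff_det_ne_zero.1
      ((LinearMap.BilinForm.nondegenerate_toMatrix_iff c).2 hEnd)
  have hJ0 : J ≠ 0 := fun h => hJdet (by rw [h, Matrix.det_zero])
  have hE : ∀ g, (LinearMap.toMatrix c c (V g))ᵀ * J * LinearMap.toMatrix c c (V g) =
      (χ g : ℚ_[p]) • J := by
    intro g
    have hcomp : E.comp (V g) (V g) = (χ g : ℚ_[p]) • E := by
      refine LinearMap.ext fun x => LinearMap.ext fun y => ?_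
      rw [LinearMap.BilinForm.comp_apply, LinearMap.smul_apply, LinearMap.smul_apply, smul_eq_mul]
      exact hEχ g x y
    rw [hJdef, ← LinearMap.BilinForm.toMatrix_comp c c E (V g) (V g), hcomp, map_smul]
  -- the matrix of `g` on `V_p A` in `1 ⊗ b` is the INTEGRAL matrix of `g` on `T_p A` in `b`
  have hNV : ∀ g, LinearMap.toMatrix c c (V g) = (LinearMap.toMatrix b b (T g)).map f := fun g =>
    LinearMap.toMatrix_baseChange ℚ_[p] (T g) b b
  -- primitive integral rescaling `J = u • J₀`, `J₀ i₀ j₀ = 1`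
  obtain ⟨u, J₀, hu, hJu, i₀, j₀, h1⟩ := exists_eq_smul_map_padicInt_of_ne_zero J hJ0
  -- the identities descend to `ℤ_p`
  have hE₀ : ∀ g, (LinearMap.toMatrix b b (T g))ᵀ * J₀ * LinearMap.toMatrix b b (T g) =
      χ g • J₀ := by
    intro g
    apply map_padicInt_injective_of_smul_eq hu
    have h := hE g
    rw [hNV g, hJu, Matrix.mul_smul, Matrix.smul_mul, ← Matrix.transpose_map, ← Matrix.map_mul,
      ← Matrix.map_mul, smul_comm] at h
    rw [h, Matrix.map_smul' _ _ _ (map_mul f)]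
    rfl
  have hJ₀t : J₀ᵀ = -J₀ := by
    apply map_padicInt_injective_of_smul_eq hu
    have h := hJt
    rw [hJu, Matrix.transpose_smul, ← Matrix.transpose_map, ← smul_neg] at h
    rw [h, Matrix.map_neg _ (map_neg f)]
  -- reduction mod `p`: the matrix of `g` on `A[p]` in the reduced basis `β`
  obtain ⟨β, hβ⟩ := exists_basis_torsionBy_coe_eq_proj hcard b
  let act : G → (A[(p : ℕ)] →ₗ[ZMod p] A[(p : ℕ)]) :=
    fun g => (DistribSMul.toAddMonoidHom (A[(p : ℕ)]) g).toZModLinearMap p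
  set Jb : Matrix (Fin d) (Fin d) (ZMod p) := J₀.map (PadicInt.toZMod (p := p)) with hJb
  have hEb : ∀ g, (LinearMap.toMatrix β β (act g))ᵀ * Jb * LinearMap.toMatrix β β (act g) =
      PadicInt.toZMod (χ g) • Jb := by
    intro g
    have hN : LinearMap.toMatrix β β (act g) = (LinearMap.toMatrix b b (T g)).map PadicInt.toZMod :=
      toMatrix_torsionBy_smul_eq_map b β hβ g
    have h := congrArg (fun M : Matrix (Fin d) (Fin d) ℤ_[p] => M.map (PadicInt.toZMod (p := p)))
      (hE₀ g)
    simp only [Matrix.map_mul, Matrix.map_smul' _ _ _ (map_mul (PadicInt.toZMod (p := p)))] at h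
    rw [hN, hJb, ← Matrix.transpose_map, h]
  have hJbt : Jbᵀ = -Jb := by
    rw [hJb, ← Matrix.transpose_map, hJ₀t, Matrix.map_neg _ (map_neg _)]
  have hJb0 : Jb ≠ 0 := fun h => by
    have hij := congrFun (congrFun h i₀) j₀
    rw [hJb, Matrix.map_apply, h1, map_one, Matrix.zero_apply] at hij
    exact one_ne_zero hij
  -- the frame `e` as a basis `β'` of `A[p]`, in which `g` has matrix `ρ g`
  let eₗ : A[(p : ℕ)] ≃ₗ[ZMod p] (Fin d → ZMod p) := { e with map_smul' := ZMod.map_smul e }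
  let β' : Module.Basis (Fin d) (ZMod p) (A[(p : ℕ)]) := (Pi.basisFun (ZMod p) (Fin d)).map eₗ.symm
  have hρ : ∀ g, ρ g = LinearMap.toMatrix β' β' (act g) := by
    intro g
    ext i j
    rw [LinearMap.toMatrix_apply, Module.Basis.map_repr, LinearEquiv.trans_apply,
      LinearEquiv.symm_symm, Pi.basisFun_repr, Module.Basis.map_apply, Pi.basisFun_apply,
      AddMonoidHom.coe_toZModLinearMap, DistribSMul.toAddMonoidHom_apply]
    change ρ g i j = e (g • e.symm (Pi.single j 1)) i
    rw [he, AddEquiv.apply_symm_apply, Matrix.mulVec_single_one, Matrix.col_apply]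
  -- change of basis `β ↔ β'`
  set P : Matrix (Fin d) (Fin d) (ZMod p) := β.toMatrix β' with hP
  set Q : Matrix (Fin d) (Fin d) (ZMod p) := β'.toMatrix β with hQ
  have hPQ : P * Q = 1 := Module.Basis.toMatrix_mul_toMatrix_flip β β'
  have hQP : Q * P = 1 := Module.Basis.toMatrix_mul_toMatrix_flip β' β
  have hNρ : ∀ g, LinearMap.toMatrix β β (act g) = P * ρ g * Q := fun g => by
    rw [hρ g, hP, hQ, basis_toMatrix_mul_linearMap_toMatrix_mul_basis_toMatrix]
  refine ⟨Pᵀ * Jb * P, ?_, ?_, fun g => ?_⟩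
  · rw [Matrix.transpose_mul, Matrix.transpose_mul, Matrix.transpose_transpose, hJbt,
      Matrix.neg_mul, Matrix.mul_neg, Matrix.mul_assoc]
  · intro h
    apply hJb0
    calc Jb = (P * Q)ᵀ * Jb * (P * Q) := by rw [hPQ, Matrix.transpose_one, Matrix.one_mul,
          Matrix.mul_one]
      _ = Qᵀ * (Pᵀ * Jb * P) * Q := by simp only [Matrix.transpose_mul, Matrix.mul_assoc]
      _ = 0 := by rw [h, Matrix.mul_zero, Matrix.zero_mul]
  · have h := hEb g
    rw [hNρ g] at h
    calc (ρ g)ᵀ * (Pᵀ * Jb * P) * ρ g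
        = (Q * P)ᵀ * ((ρ g)ᵀ * (Pᵀ * Jb * P) * ρ g) * (Q * P) := by
          rw [hQP, Matrix.transpose_one, Matrix.one_mul, Matrix.mul_one]
      _ = Pᵀ * ((P * ρ g * Q)ᵀ * Jb * (P * ρ g * Q)) * P := by
          simp only [Matrix.transpose_mul, Matrix.mul_assoc]
      _ = PadicInt.toZMod (χ g) • (Pᵀ * Jb * P) := by
          rw [h, Matrix.mul_smul, Matrix.smul_mul, Matrix.mul_assoc]

end Lattice

/-! ## 5. The mod-`p` level: `H¹(B_K̄, 𝔽_p) ⊗ k` is symplectic of multiplier `ε̄⁻¹` when irreducible -/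

section ModPLevel

variable {K : Type} [Field K] (B : AbelianVariety K) (p : ℕ) [Fact p.Prime]

/-- **`ρ̄_{B,p} ⊗ k` is symplectic with multiplier `ε̄⁻¹` when it is irreducible, from the Weil
pairing fact.**  Granted `weilPairing_rationalTateModule`, let `B/K` be an abelian variety, `p` a
prime invertible in `K`, `d = 2 dim B`, `(ρ₀, e)` a frame of `B[p](K̄)`
(`e (σ • P) = ρ₀(σ) · e(P)`), `k` a topological field and `ι : 𝔽_p →+* k`.  If
`ρ̄ := ρ₀^∨ ⊗_ι k` — the representation on `H¹(B_K̄, 𝔽_p) ⊗ k = (B[p] ⊗ k)^∨` in the dual frame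
(BCGP 2025, §1.8.11: "the Galois representations associated to `T_p(A)` and `A[p]` are the dual
representations") — is irreducible, then `ρ̄` is symplectic of multiplier
`σ ↦ ι(χ̄_p(σ))⁻¹`, `χ̄_p = χ_p mod p` the mod-`p` cyclotomic character (§1.8.11:
"`ρ̄_{A,p} : G_F → GSp₄(𝔽̄_p)`", similitude `ε̄⁻¹`).  Proof: the Weil form on `V_p B` leaves on
`B[p]` a non-zero alternating matrix `J₁` with `ρ₀(σ)ᵀ J₁ ρ₀(σ) = χ̄_p(σ) J₁`
(`exists_alternating_gram_torsionFrame_of_bilinForm`, `toZMod_cyclotomicCharacter_apply`); its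
column space over `k` is `ρ̄`-stable (`transpose_inv_mulVec_mem_range_of_transpose_mul_mul`) and
non-zero, so it is everything and `J₁` is invertible; `J₁⁻¹` is then a Gram matrix for the dual
with the inverse multiplier (`symplectic_inv_gram_identity`).  In print the passage to
`GSp₄(𝔽̄_p)` is made under "a polarization of degree prime to `p`"; irreducibility replaces it.
[cite: BoxerCalegariGeePilloni2025, §1.8.11] [cite: Milne1986AbelianVarieties, §16]
[cite: SerreTate1968, §1] -/
theorem isSymplecticWithMultiplierFun_dualTorsionFrame_baseChange_of_weilPairing_of_isIrreducible
    (hWeil : weilPairing_rationalTateModule) [NeZero (p : K)] {d : ℕ} (hd : 2 * B.dim = d)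
    (ρ₀ : FramedGaloisRep K (ZMod p) d) (e : B.geomTorsion (p : ℕ) ≃+ (Fin d → ZMod p))
    (he : ∀ (σ : absoluteGaloisGroup K) (P : B.geomTorsion (p : ℕ)),
      e (σ • P) = ((ρ₀ σ : GL (Fin d) (ZMod p)) : Matrix (Fin d) (Fin d) (ZMod p)) *ᵥ e P)
    (k : Type*) [Field k] [TopologicalSpace k] [IsTopologicalRing k] (ι : ZMod p →+* k)
    (hirr : FramedRep.IsIrreducible
      ((FramedRep.dual ρ₀).baseChange ι continuous_of_discreteTopology)) :
    FramedGaloisRep.IsSymplecticWithMultiplierFun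
      ((FramedRep.dual ρ₀).baseChange ι continuous_of_discreteTopology)
      (fun σ => (((Units.map ι.toMonoidHom (modPCyclotomicCharacterZMod K p σ))⁻¹ : kˣ) : k)) := by
  classical
  have hp : (p : K) ≠ 0 := NeZero.ne _
  set ρb := (FramedRep.dual ρ₀).baseChange ι continuous_of_discreteTopology with hρb
  have hval : ∀ σ, (ρb σ).val =
      ((((ρ₀ σ⁻¹ : GL (Fin d) (ZMod p))) : Matrix (Fin d) (Fin d) (ZMod p)).map ι)ᵀ :=
    fun σ => FramedRep.val_dual_baseChange_apply ι _ ρ₀ σ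
  rcases Nat.eq_zero_or_pos d with hd0 | hdpos
  · -- `d = 0`: nothing to prove
    subst hd0
    refine ⟨0, ?_, ?_, fun σ => ?_⟩
    · ext i j; exact Fin.elim0 i
    · rw [Matrix.det_isEmpty]; exact isUnit_one
    · ext i j; exact Fin.elim0 i
  -- the Weil form and its reduction on `B[p]` in the frame `e`
  obtain ⟨E, hEalt, hEnd, hEχ⟩ := hWeil B p hp
  have hcard : ∀ n, Nat.card ((B.geomPoints)[(p ^ n : ℕ)]) = p ^ (d * n) := fun n => by
    rw [← hd]; exact B.natCard_geomTorsion_pow' p hp n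
  obtain ⟨J₁, hJ₁t, hJ₁0, hJ₁⟩ := exists_alternating_gram_torsionFrame_of_bilinForm hcard hdpos E
    hEalt hEnd (fun σ => ((GaloisRep.cyclotomicCharacter K p σ : ℤ_[p]ˣ) : ℤ_[p])) hEχ e
    (fun σ => ((ρ₀ σ : GL (Fin d) (ZMod p)) : Matrix (Fin d) (Fin d) (ZMod p))) he
  -- push to `k`
  set χb : absoluteGaloisGroup K → k :=
    fun σ => ((Units.map ι.toMonoidHom (modPCyclotomicCharacterZMod K p σ) : kˣ) : k) with hχb
  set J : Matrix (Fin d) (Fin d) k := J₁.map ι with hJ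
  set N : absoluteGaloisGroup K → Matrix (Fin d) (Fin d) k :=
    fun σ => ((ρ₀ σ : GL (Fin d) (ZMod p)) : Matrix (Fin d) (Fin d) (ZMod p)).map ι with hN
  have hNE : ∀ σ, (N σ)ᵀ * J * N σ = χb σ • J := by
    intro σ
    have h := congrArg (fun M : Matrix (Fin d) (Fin d) (ZMod p) => M.map ι) (hJ₁ σ)
    simp only [Matrix.map_mul, Matrix.map_smul' _ _ _ (map_mul ι)] at h
    rw [hN, hJ, ← Matrix.transpose_map, h, toZMod_cyclotomicCharacter_apply]
    rfl
  have hJt : Jᵀ = -J := by rw [hJ, ← Matrix.transpose_map, hJ₁t, Matrix.map_neg _ (map_neg ι)]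
  have hJ0 : J ≠ 0 := by
    intro h
    apply hJ₁0
    refine Matrix.map_injective ι.injective ?_
    show J₁.map ι = (0 : Matrix (Fin d) (Fin d) (ZMod p)).map ι
    rw [Matrix.map_zero _ (map_zero ι)]
    exact h
  have hNN' : ∀ σ, N σ * N σ⁻¹ = 1 := by
    intro σ
    simp only [hN]
    rw [← Matrix.map_mul, ← Units.val_mul, ← map_mul, mul_inv_cancel, map_one, Units.val_one,
      Matrix.map_one ι (map_zero ι) (map_one ι)]
  have hNu : ∀ σ, IsUnit (N σ).det := fun σ => Matrix.isUnit_det_of_right_inverse (hNN' σ)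
  have hχb0 : ∀ σ, χb σ ≠ 0 := fun σ => Units.ne_zero _
  have hvalN : ∀ σ, (ρb σ).val = (N σ⁻¹)ᵀ := fun σ => by rw [hval σ]
  -- the column space of `J` is `ρ̄`-stable and non-zero, hence everything: `J` is invertible
  have hirr' : Representation.IsIrreducible ρb.toRepresentation := hirr
  let W : Subrepresentation ρb.toRepresentation :=
    ⟨LinearMap.range J.mulVecLin, fun σ v hv => by
      obtain ⟨x, rfl⟩ := hv
      rw [FramedRep.toRepresentation_apply_apply, hvalN σ, ← Matrix.inv_eq_right_inv (hNN' σ)]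
      obtain ⟨y, hy⟩ :=
        transpose_inv_mulVec_mem_range_of_transpose_mul_mul (hNu σ) (hNE σ) (hχb0 σ) x
      exact ⟨y, hy.symm⟩⟩
  have hWtop : LinearMap.range J.mulVecLin = ⊤ := by
    rcases hirr'.eq_bot_or_eq_top W with h | h
    · exact absurd (show W.toSubmodule = ⊥ by rw [h]; rfl) (range_mulVecLin_ne_bot_of_ne_zero hJ0)
    · show W.toSubmodule = ⊤
      rw [h]
      rfl
  have hJu : IsUnit J.det := isUnit_det_of_range_mulVecLin_eq_top hWtop
  have hJdet : J.det ≠ 0 := hJu.ne_zero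
  -- `J⁻¹` is a Gram matrix for the dual, with the inverse multiplier
  have hJinvt : (J⁻¹)ᵀ = -J⁻¹ := by
    rw [Matrix.transpose_nonsing_inv, hJt]
    refine Matrix.inv_eq_right_inv ?_
    rw [neg_mul_neg, Matrix.mul_nonsing_inv J hJu]
  have hcc' : ∀ σ, χb σ * χb σ⁻¹ = 1 := fun σ => by
    simp only [hχb]
    rw [← Units.val_mul, ← map_mul, ← map_mul, mul_inv_cancel, map_one, map_one, Units.val_one]
  refine ⟨J⁻¹, hJinvt, Matrix.isUnit_nonsing_inv_det J hJu, fun σ => ?_⟩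
  rw [hvalN σ, Matrix.transpose_transpose,
    symplectic_inv_gram_identity (hNN' σ) hJdet (hNE σ) (hcc' σ)]
  simp only [hχb, map_inv]

/-- **The case of an abelian surface over `ℚ`**, in the exact shape of the "multiplier `ε̄⁻¹`"
clause of the good-prime binders of `BcgpSerreWreathFixedSimilitudeImprimitiveSurfacesProofs.lean`
(`ρ̄_{A,p} ⊗ k` literal: the base change along `ZMod.castHom (dvd_refl p) k` of the dual of a
frame `ρ₀` of `A[p](ℚ̄)`; `k` algebraically closed of characteristic `p`, discrete).
[cite: BoxerCalegariGeePilloni2025, §1.8.11] [cite: Milne1986AbelianVarieties, §16] -/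
theorem isSymplecticWithMultiplierFun_dualTorsionFrame_baseChange_surface_of_weilPairing_of_isIrreducible
    (hWeil : weilPairing_rationalTateModule) (A : AbelianVariety ℚ) (hA : A.dim = 2) (p : ℕ)
    [Fact p.Prime] (ρ₀ : FramedGaloisRep ℚ (ZMod p) 4) (e : A.geomTorsion (p : ℕ) ≃+ (Fin 4 → ZMod p))
    (he : ∀ (σ : absoluteGaloisGroup ℚ) (P : A.geomTorsion (p : ℕ)),
      e (σ • P) = ((ρ₀ σ : GL (Fin 4) (ZMod p)) : Matrix (Fin 4) (Fin 4) (ZMod p)) *ᵥ e P)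
    (k : Type) [Field k] [CharP k p] [TopologicalSpace k] [DiscreteTopology k]
    (hirr : FramedRep.IsIrreducible ((FramedRep.dual ρ₀).baseChange (ZMod.castHom (dvd_refl p) k)
      continuous_of_discreteTopology)) :
    FramedGaloisRep.IsSymplecticWithMultiplierFun
      ((FramedRep.dual ρ₀).baseChange (ZMod.castHom (dvd_refl p) k)
        continuous_of_discreteTopology) (fun g => (((Units.map
        (ZMod.castHom (dvd_refl p) k).toMonoidHom
        ((modularCyclotomicCharacter (AlgebraicClosure ℚ)
          (HasEnoughRootsOfUnity.natCard_rootsOfUnity (AlgebraicClosure ℚ) p)).comp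
        (MulSemiringAction.toRingAut (Field.absoluteGaloisGroup ℚ) (AlgebraicClosure ℚ)) g))⁻¹ :
          kˣ) : k)) :=
  haveI : IsTopologicalRing k := DiscreteTopology.topologicalRing
  haveI : NeZero ((p : ℕ) : ℚ) := ⟨by exact_mod_cast (Fact.out : p.Prime).ne_zero⟩
  isSymplecticWithMultiplierFun_dualTorsionFrame_baseChange_of_weilPairing_of_isIrreducible A p
    hWeil (by rw [hA]) ρ₀ e he k (ZMod.castHom (dvd_refl p) k) hirr

/-- **The case of an abelian surface over `ℚ`, `p`-adic level**, in the exact shape of the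
"multiplier `ε_p⁻¹`" clause of the good-prime binders of
`BcgpSerreWreathFixedSimilitudeImprimitiveSurfacesProofs.lean`.
[cite: BoxerCalegariGeePilloni2025, §1.8.11] [cite: Milne1986AbelianVarieties, §16 (Lemma 16.2 (e))] -/
theorem isSymplecticWithMultiplierFun_dualFramed_surface_of_weilPairing
    (hWeil : weilPairing_rationalTateModule) (A : AbelianVariety ℚ) (p : ℕ) [Fact p.Prime]
    (b : Module.Basis (Fin 4) ℚ_[p] (A.rationalTateModule p))
    (r : FramedGaloisRep ℚ (PadicAlgCl p) 4)
    (hr : ∀ g : absoluteGaloisGroup ℚ,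
      (r g).val = ((LinearMap.toMatrix b b (A.rationalTateRep p g⁻¹)).map
        (algebraMap ℚ_[p] (PadicAlgCl p))).transpose) :
    r.IsSymplecticWithMultiplierFun (fun g => algebraMap ℚ_[p] (PadicAlgCl p)
      ((((GaloisRep.cyclotomicCharacter ℚ p g)⁻¹ : ℤ_[p]ˣ) : ℤ_[p]) : ℚ_[p])) :=
  isSymplecticWithMultiplierFun_dualFramed_of_weilPairing A p hWeil
    (by exact_mod_cast (Fact.out : p.Prime).ne_zero) b r hr

end ModPLevel

end Literature.NumberTheory.DiophantineGeometry
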